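import Summits.Ventures.PercRepro.RankLevelSetBiIndepLR

/-! # RankLevelSetBiIndepLRSum — THE CLASS OF MATROIDS SATISFYING THE LIKELIHOOD-RATIO MONOTONICITY (LR) IS CLOSED
UNDER DIRECT SUMS WITH A LOG-CONCAVE SUMMAND (night-1 g26; dossier §38.10)

THEOREM (`biIndepLR_disjointSum`): if `M` and `N` satisfy `BiIndepLR` (the all-pairs TP2 form of (LR),
`RankLevelSetBiIndepLR`) and both bi-independent profiles are PF₂ (`BiIndepPF2`: log-concave with no internal zeros,
in its all-spreads form `D_{x−k}·D_{y+k} ≤ D_x·D_y` for `x ≤ y`, `k ≤ x` — the consequence of the Lorentzian ULC fact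
`BiIndepULC` that the argument needs), then `M ⊕ N` satisfies `BiIndepLR`.

PROOF (Cauchy–Binet for 2-row arrays). For `y ∈ E_M` the marked counts convolve (`RankLevelSetBiIndepSum`):
`a_p(M ⊕ N) = Σ_i a_i(M)·K(p, i)` and `b_p(M ⊕ N) = Σ_i b_i(M)·K(p, i)` with the SAME Toeplitz kernel
`K(p, i) = D_{p−i}(N)` (`i ≤ p`, else `0`; `convKer`). A PF₂ sequence has a TP2 Toeplitz kernel
(`convKer_tp2`: `K(q,i)·K(p,j) ≤ K(p,i)·K(q,j)` for `i ≤ j`, `p ≤ q` — the spread pair `(p−j, q−i)` against the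
closer pair `(p−i, q−j)` of the same sum), and the composition of a TP2 kernel with a TP2 2-row array is TP2
(`tp2_conv`): `a_q b_p − a_p b_q = Σ_{i<j} (a_i b_j − a_j b_i)·(K(q,i)K(p,j) − K(p,i)K(q,j)) ≤ 0`, written
without subtraction through the rearrangement inequality `mul_add_mul_le_mul_add_mul` on the doubled sum.
`y ∈ E_N` is the same with the summands swapped (`Matroid.disjointSum_comm`).
Nothing here asserts (LR) or ULC; every declaration has a docstring; imports: the cell's own modules and Mathlib
only. Axioms: standard. -/

namespace PercRepro

open Set Matroid

variable {α : Type}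

/-! ## PF₂ profiles and their Toeplitz kernels -/

/-- **PF₂ (log-concave, no internal zeros) in its all-spreads form** (a `Prop`, NOT asserted): for `x ≤ y` and
`k ≤ x`, `D_{x−k} · D_{y+k} ≤ D_x · D_y` — a product of the bi-independent profile at a pair of levels dominates the
product at any more spread pair of the same sum. It follows from the Lorentzian ULC fact `BiIndepULC`. -/
def BiIndepPF2 (N : Matroid α) [N.Finite] : Prop :=
  ∀ x y k : ℕ, x ≤ y → k ≤ x →
    biIndepCount N (x - k) * biIndepCount N (y + k) ≤ biIndepCount N x * biIndepCount N y

/-- The truncated Toeplitz kernel of the profile of `N`: `K(p, i) = D_{p−i}(N)` for `i ≤ p` and `0` otherwise. -/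
noncomputable def convKer (N : Matroid α) [N.Finite] (p i : ℕ) : ℕ :=
  if i ≤ p then biIndepCount N (p - i) else 0

/-- **A PF₂ profile has a TP2 kernel**: `K(q,i)·K(p,j) ≤ K(p,i)·K(q,j)` for `i ≤ j` and `p ≤ q`. -/
lemma convKer_tp2 {N : Matroid α} [N.Finite] (hN : BiIndepPF2 N) {p q i j : ℕ} (hpq : p ≤ q) (hij : i ≤ j) :
    convKer N q i * convKer N p j ≤ convKer N p i * convKer N q j := by
  unfold convKer
  by_cases hjp : j ≤ p
  · have hip : i ≤ p := hij.trans hjp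
    have hiq : i ≤ q := hip.trans hpq
    have hjq : j ≤ q := hjp.trans hpq
    simp only [hip, hiq, hjp, hjq, if_true]
    by_cases hcase : j - i ≤ q - p
    · -- closer pair (p − i, q − j), spread by k = j − i
      have h := hN (p - i) (q - j) (j - i) (by omega) (by omega)
      rw [show p - i - (j - i) = p - j by omega, show q - j + (j - i) = q - i by omega] at h
      calc biIndepCount N (q - i) * biIndepCount N (p - j)
          = biIndepCount N (p - j) * biIndepCount N (q - i) := by ring
        _ ≤ biIndepCount N (p - i) * biIndepCount N (q - j) := h
    · -- closer pair (q − j, p − i), spread by k = q − p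
      have h := hN (q - j) (p - i) (q - p) (by omega) (by omega)
      rw [show q - j - (q - p) = p - j by omega, show p - i + (q - p) = q - i by omega] at h
      calc biIndepCount N (q - i) * biIndepCount N (p - j)
          = biIndepCount N (p - j) * biIndepCount N (q - i) := by ring
        _ ≤ biIndepCount N (q - j) * biIndepCount N (p - i) := h
        _ = biIndepCount N (p - i) * biIndepCount N (q - j) := by ring
  · simp only [hjp, if_false, mul_zero, zero_le]

/-! ## The composition lemma (pure arithmetic) -/

/-- **TP2 is preserved by composition with a TP2 kernel** (the 2-row Cauchy–Binet inequality): if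
`a_j b_i ≤ a_i b_j` for `i ≤ j` and `K(q,i)K(p,j) ≤ K(p,i)K(q,j)` for `i ≤ j`, then
`(Σ_i a_i K(q,i))·(Σ_j b_j K(p,j)) ≤ (Σ_i a_i K(p,i))·(Σ_j b_j K(q,j))`. -/
lemma tp2_conv {a b : ℕ → ℕ} {K : ℕ → ℕ → ℕ} {p q : ℕ}
    (hab : ∀ i j, i ≤ j → a j * b i ≤ a i * b j)
    (hK : ∀ i j, i ≤ j → K q i * K p j ≤ K p i * K q j) (R : Finset ℕ) :
    (∑ i ∈ R, a i * K q i) * (∑ j ∈ R, b j * K p j) ≤ (∑ i ∈ R, a i * K p i) * (∑ j ∈ R, b j * K q j) := by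
  rw [Finset.sum_mul_sum, Finset.sum_mul_sum]
  -- the termwise rearrangement inequality on the doubled sum
  have hterm : ∀ i j, a i * K q i * (b j * K p j) + a j * K q j * (b i * K p i) ≤
      a i * K p i * (b j * K q j) + a j * K p j * (b i * K q i) := by
    intro i j
    rcases le_total i j with hij | hji
    · have h1 := hab i j hij
      have h2 := hK i j hij
      have := mul_add_mul_le_mul_add_mul h1 h2
      -- `a j * b i * (K p i * K q j) + a i * b j * (K q i * K p j) ≤ a j * b i * (K q i * K p j) + a i * b j * (K p i * K q j)`
      nlinarith [this]
    · have h1 := hab j i hji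
      have h2 := hK j i hji
      have := mul_add_mul_le_mul_add_mul h1 h2
      nlinarith [this]
  set F : ℕ → ℕ → ℕ := fun i j => a i * K q i * (b j * K p j) with hF
  set G : ℕ → ℕ → ℕ := fun i j => a i * K p i * (b j * K q j) with hG
  have hdoubleF : 2 * ∑ i ∈ R, ∑ j ∈ R, F i j = ∑ i ∈ R, ∑ j ∈ R, (F i j + F j i) := by
    have hc : ∑ i ∈ R, ∑ j ∈ R, F i j = ∑ i ∈ R, ∑ j ∈ R, F j i := Finset.sum_comm
    rw [two_mul]
    nth_rewrite 2 [hc]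
    rw [← Finset.sum_add_distrib]
    refine Finset.sum_congr rfl (fun i _ => ?_)
    rw [← Finset.sum_add_distrib]
  have hdoubleG : 2 * ∑ i ∈ R, ∑ j ∈ R, G i j = ∑ i ∈ R, ∑ j ∈ R, (G i j + G j i) := by
    have hc : ∑ i ∈ R, ∑ j ∈ R, G i j = ∑ i ∈ R, ∑ j ∈ R, G j i := Finset.sum_comm
    rw [two_mul]
    nth_rewrite 2 [hc]
    rw [← Finset.sum_add_distrib]
    refine Finset.sum_congr rfl (fun i _ => ?_)
    rw [← Finset.sum_add_distrib]
  have hdouble : 2 * ∑ i ∈ R, ∑ j ∈ R, F i j ≤ 2 * ∑ i ∈ R, ∑ j ∈ R, G i j := by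
    rw [hdoubleF, hdoubleG]
    exact Finset.sum_le_sum (fun i _ => Finset.sum_le_sum (fun j _ => hterm i j))
  exact Nat.le_of_mul_le_mul_left hdouble (by norm_num)

/-! ## The convolutions through the kernel -/

variable {M N : Matroid α} [M.Finite] [N.Finite] {h : Disjoint M.E N.E}

/-- A convolution over `range (p + 1)` with `D_{p−a}(N)` is the same sum over any larger `range (q + 1)` with the
truncated kernel. -/
lemma sum_range_convKer (X : ℕ → ℕ) {p q : ℕ} (hpq : p ≤ q) :
    ∑ a ∈ Finset.range (p + 1), X a * (biIndep N (p - a)).ncard = ∑ a ∈ Finset.range (q + 1), X a * convKer N p a := by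
  have e1 : ∑ a ∈ Finset.range (p + 1), X a * (biIndep N (p - a)).ncard =
      ∑ a ∈ Finset.range (p + 1), X a * convKer N p a := by
    refine Finset.sum_congr rfl (fun a ha => ?_)
    rw [Finset.mem_range] at ha
    simp only [convKer, biIndepCount, show a ≤ p by omega, if_true]
  rw [e1]
  apply Finset.sum_subset (Finset.range_mono (by omega : p + 1 ≤ q + 1))
  intro a _ ha
  rw [Finset.mem_range, not_lt] at ha
  simp only [convKer, show ¬ a ≤ p by omega, if_false, mul_zero]

/-- **The through-`y` count of `M ⊕ N` through the kernel** (`y ∈ E_M`). -/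
lemma yThroughCount_disjointSum {y : α} (hy : y ∈ M.E) {p q : ℕ} (hpq : p ≤ q) :
    yThroughCount (M.disjointSum N h) y p =
      ∑ a ∈ Finset.range (q + 1), yThroughCount M y a * convKer N p a := by
  unfold yThroughCount
  rw [ncard_mem_biIndep_disjointSum (h := h) hy p]
  exact sum_range_convKer (fun a => {Q₁ ∈ biIndep M (a + 1) | y ∈ Q₁}.ncard) hpq

/-- **The avoid-`y` count of `M ⊕ N` through the kernel** (`y ∈ E_M`). -/
lemma yAvoidCount_disjointSum {y : α} (hy : y ∈ M.E) {p q : ℕ} (hpq : p ≤ q) :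
    yAvoidCount (M.disjointSum N h) y p =
      ∑ a ∈ Finset.range (q + 1), yAvoidCount M y a * convKer N p a := by
  unfold yAvoidCount
  rw [ncard_not_mem_biIndep_disjointSum (h := h) hy p]
  exact sum_range_convKer (fun a => {Z₁ ∈ biIndep M a | y ∉ Z₁}.ncard) hpq

/-! ## The closure theorem -/

/-- **(LR) at an element of the first summand**: if `M` satisfies (LR) at `y ∈ E_M` and the profile of `N` is PF₂,
then `M ⊕ N` satisfies (LR) at `y`. -/
theorem biIndepLR_disjointSum_left (hM : BiIndepLR M) (hN : BiIndepPF2 N) {y : α} (hy : y ∈ M.E)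
    {p q : ℕ} (hpq : p ≤ q) :
    yThroughCount (M.disjointSum N h) y q * yAvoidCount (M.disjointSum N h) y p ≤
      yThroughCount (M.disjointSum N h) y p * yAvoidCount (M.disjointSum N h) y q := by
  rw [yThroughCount_disjointSum (h := h) hy (le_refl q), yAvoidCount_disjointSum (h := h) hy hpq,
    yThroughCount_disjointSum (h := h) hy hpq, yAvoidCount_disjointSum (h := h) hy (le_refl q)]
  exact tp2_conv (a := yThroughCount M y) (b := yAvoidCount M y) (K := convKer N) (p := p) (q := q)
    (fun i j hij => hM y hy i j hij) (fun i j hij => convKer_tp2 hN hpq hij) (Finset.range (q + 1))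

/-- **THE CLASS OF (LR)-MATROIDS WITH PF₂ PROFILES IS CLOSED UNDER DIRECT SUMS**:
`BiIndepLR M → BiIndepLR N → BiIndepPF2 M → BiIndepPF2 N → BiIndepLR (M ⊕ N)`. -/
theorem biIndepLR_disjointSum (hM : BiIndepLR M) (hN : BiIndepLR N) (hM2 : BiIndepPF2 M) (hN2 : BiIndepPF2 N) :
    BiIndepLR (M.disjointSum N h) := by
  intro y hy p q hpq
  rw [Matroid.disjointSum_ground_eq] at hy
  rcases hy with hyM | hyN
  · exact biIndepLR_disjointSum_left (h := h) hM hN2 hyM hpq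
  · have e : M.disjointSum N h = N.disjointSum M h.symm := Matroid.disjointSum_comm
    rw [e]
    exact biIndepLR_disjointSum_left (h := h.symm) hN hM2 hyN hpq

end PercRepro
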